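import Literature.Analysis.FluidPDE.PlanarInterpShearBand
import Literature.Analysis.FluidPDE.PlanarShearedCornerElement
import HarnessLib

/-!
# The interpolated-shear corner element: the diagonal graph band with a shear profile

Topic `Literature/Analysis/FluidPDE`. The corner element of `PlanarCornerElement.lean` (graph band
of the diagonal frame `A`) built on the INTERPOLATED-SHEAR band of `PlanarInterpShearBand.lean`
(static graph `T`, shear profile `λ(u)`, compensated transverse coordinate `F(u, s)`):

* `ishCornerScalar Gp λ T F Ξ Ξₓ t z = Gp ((Ψ(t, A z))₁)`,
* `ishCornerVelocity λ λ' T Tₓ F Fₓ Fₛ g gₓ t z = A⁻¹ V(t, A z)`,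
* `ishCornerStream λ T F g t z = ½ H(t, A z)`.

Transport (`transport_ishCornerScalar`, from the pullback identity of the band at a point where
`F` solves `(1 + λ' s) Fₛ - λ Fₓ = 1`), the stream-function identity
(`ishCornerVelocity_eq_perpGrad_ishCornerStream`), incompressibility
(`divergence_ishCornerVelocity`), smoothness, the static case, and the reduction to the sheared
corner element for a constant profile and `F(u, s) = s` (`ishCornerScalar_const`, …). With the
profile `shearProfile D (· - u₀)` of `PlanarInterpShearProfile.lean` (`= ± 1/2` beyond `u₀ ∓ D`)
BOTH arms of the corner are unsheared, so width transitions can be handed over on either arm.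

Folklore; no named facts. Infrastructure towards a discharge of `acm_compatible_blocks`
(`QuasiSelfSimilarCompatibleBlocks.lean`).

## References

* G. Alberti, G. Crippa, A. L. Mazzucato, *Exponential self-similar mixing by incompressible
  flows*, J. Amer. Math. Soc. 32 (2019), 445–490, §7 (arXiv:1605.02090).
-/

noncomputable section

open Function Set Filter
open scoped Topology ContDiff

namespace Literature.Analysis.FluidPDE

namespace PlanarKinematics

/-- The plane `ℝ²` as a Euclidean space. [folklore] -/
local notation "E²" => EuclideanSpace ℝ (Fin 2)

variable {G : Type*} [NormedAddCommGroup G] [NormedSpace ℝ G]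

/-! ## Definitions -/

/-- **Interpolated-shear corner element, scalar**: `Θ(t, z) = Gp ((Ψ(t, A z))₁)`. [folklore] -/
def ishCornerScalar (Gp : ℝ → G) (lam : ℝ → ℝ) (T : ℝ → ℝ) (F : ℝ → ℝ → ℝ) (Ξ Ξx : ℝ → ℝ → ℝ) (t : ℝ)
    (z : E²) : G :=
  Gp ((ishPullback lam T F Ξ Ξx t (diagFrame z)) 1)

/-- **Interpolated-shear corner element, velocity**: `V(t, z) = A⁻¹ V(t, A z)`. [folklore] -/
def ishCornerVelocity (lam lamx : ℝ → ℝ) (T Tx : ℝ → ℝ) (F Fu Fs : ℝ → ℝ → ℝ) (g gx : ℝ → ℝ → ℝ) (t : ℝ)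
    (z : E²) : E² :=
  diagFrameInv (ishVelocity lam lamx T Tx F Fu Fs g gx t (diagFrame z))

/-- **Interpolated-shear corner element, stream function**: `H(t, z) = ½ H(t, A z)`. [folklore] -/
def ishCornerStream (lam : ℝ → ℝ) (T : ℝ → ℝ) (F : ℝ → ℝ → ℝ) (g : ℝ → ℝ → ℝ) (t : ℝ) (z : E²) : ℝ :=
  2⁻¹ * ishStream lam T F g t (diagFrame z)

omit [NormedAddCommGroup G] [NormedSpace ℝ G] in
/-- Unfolding the scalar. [folklore] -/
@[simp]
theorem ishCornerScalar_apply (Gp : ℝ → G) (lam : ℝ → ℝ) (T : ℝ → ℝ) (F : ℝ → ℝ → ℝ) (Ξ Ξx : ℝ → ℝ → ℝ)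
    (t : ℝ) (z : E²) :
    ishCornerScalar Gp lam T F Ξ Ξx t z = Gp ((ishPullback lam T F Ξ Ξx t (diagFrame z)) 1) := rfl

/-- Unfolding the velocity. [folklore] -/
@[simp]
theorem ishCornerVelocity_apply (lam lamx : ℝ → ℝ) (T Tx : ℝ → ℝ) (F Fu Fs : ℝ → ℝ → ℝ) (g gx : ℝ → ℝ → ℝ)
    (t : ℝ) (z : E²) :
    ishCornerVelocity lam lamx T Tx F Fu Fs g gx t z =
      diagFrameInv (ishVelocity lam lamx T Tx F Fu Fs g gx t (diagFrame z)) := rfl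

/-- Unfolding the stream function. [folklore] -/
@[simp]
theorem ishCornerStream_apply (lam : ℝ → ℝ) (T : ℝ → ℝ) (F : ℝ → ℝ → ℝ) (g : ℝ → ℝ → ℝ) (t : ℝ) (z : E²) :
    ishCornerStream lam T F g t z = 2⁻¹ * ishStream lam T F g t (diagFrame z) := rfl

omit [NormedAddCommGroup G] [NormedSpace ℝ G] in
/-- **A constant profile and `F(u, s) = s` give the sheared corner element** (scalar). [folklore] -/
theorem ishCornerScalar_const (Gp : ℝ → G) (c : ℝ) (T : ℝ → ℝ) (Ξ Ξx : ℝ → ℝ → ℝ) :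
    ishCornerScalar Gp (fun _ => c) T (fun _ s => s) Ξ Ξx = shCornerScalar Gp c T Ξ Ξx := by
  funext t z
  simp only [ishCornerScalar, shCornerScalar, ishPullback_const]

/-- **A constant profile and `F(u, s) = s` give the sheared corner element** (velocity).
[folklore] -/
theorem ishCornerVelocity_const (c : ℝ) (T Tx : ℝ → ℝ) (g gx : ℝ → ℝ → ℝ) :
    ishCornerVelocity (fun _ => c) (fun _ => 0) T Tx (fun _ s => s) (fun _ _ => 0) (fun _ _ => 1) g gx =
      shCornerVelocity c g gx T Tx := by
  funext t z
  rw [ishCornerVelocity_apply, shCornerVelocity_apply, ishVelocity_const]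

/-- **A constant profile and `F(u, s) = s` give the sheared corner element** (stream function).
[folklore] -/
theorem ishCornerStream_const (c : ℝ) (T : ℝ → ℝ) (g : ℝ → ℝ → ℝ) :
    ishCornerStream (fun _ => c) T (fun _ s => s) g = shCornerStream c g T := by
  funext t z
  rw [ishCornerStream_apply, shCornerStream_apply, ishStream_const]

/-! ## Transport, stream function, incompressibility -/

/-- **The interpolated-shear corner element is transported**: with the hypotheses of
`ish_pullback_identity` at the frame point `(t, A z)` and a profile `Gp` differentiable at the
transverse reference coordinate, `∂ₜΘ + D_zΘ[V] = 0` at `(t, z)`. [folklore] -/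
theorem transport_ishCornerScalar {Gp : ℝ → G} {lam lamx T Tx : ℝ → ℝ} {F Fu Fs : ℝ → ℝ → ℝ}
    {Ξ Ξx Ξt Ξxx Ξxt : ℝ → ℝ → ℝ} {t : ℝ} {z : E²}
    (hG : DifferentiableAt ℝ Gp ((ishPullback lam T F Ξ Ξx t (diagFrame z)) 1))
    (hlam : HasDerivAt lam (lamx ((diagFrame z) 0)) ((diagFrame z) 0))
    (hTx : HasDerivAt T (Tx ((diagFrame z) 0)) ((diagFrame z) 0))
    (hF : HasFDerivAt (uncurry F)
      (Fu ((diagFrame z) 0) ((diagFrame z) 1 - T ((diagFrame z) 0)) • ContinuousLinearMap.fst ℝ ℝ ℝ +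
        Fs ((diagFrame z) 0) ((diagFrame z) 1 - T ((diagFrame z) 0)) • ContinuousLinearMap.snd ℝ ℝ ℝ)
      ((diagFrame z) 0, (diagFrame z) 1 - T ((diagFrame z) 0)))
    (hpde : (1 + lamx ((diagFrame z) 0) * ((diagFrame z) 1 - T ((diagFrame z) 0))) *
        Fs ((diagFrame z) 0) ((diagFrame z) 1 - T ((diagFrame z) 0)) -
      lam ((diagFrame z) 0) * Fu ((diagFrame z) 0) ((diagFrame z) 1 - T ((diagFrame z) 0)) = 1)
    (ht : HasDerivAt (fun s => Ξ s (ishAbscissa lam T (diagFrame z))) (Ξt t (ishAbscissa lam T (diagFrame z))) t)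
    (hx : HasDerivAt (Ξ t) (Ξx t (ishAbscissa lam T (diagFrame z))) (ishAbscissa lam T (diagFrame z)))
    (hxx : HasDerivAt (Ξx t) (Ξxx t (ishAbscissa lam T (diagFrame z))) (ishAbscissa lam T (diagFrame z)))
    (hxt : HasDerivAt (fun s => Ξx s (ishAbscissa lam T (diagFrame z)))
      (Ξxt t (ishAbscissa lam T (diagFrame z))) t)
    (hne : Ξx t (ishAbscissa lam T (diagFrame z)) ≠ 0) :
    deriv (fun s => ishCornerScalar Gp lam T F Ξ Ξx s z) t +
      fderiv ℝ (ishCornerScalar Gp lam T F Ξ Ξx t) z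
        (ishCornerVelocity lam lamx T Tx F Fu Fs (axialRate Ξx Ξt) (axialRateDeriv Ξx Ξt Ξxx Ξxt) t z) = 0 := by
  set Θf : ℝ → E² → G := fun s w => Gp ((ishPullback lam T F Ξ Ξx s w) 1) with hΘf
  have hf1 : DifferentiableAt ℝ (fun w : E² => w 1) (ishPullback lam T F Ξ Ξx t (diagFrame z)) :=
    (EuclideanSpace.proj (1 : Fin 2) : E² →L[ℝ] ℝ).differentiableAt
  have hproj : DifferentiableAt ℝ (fun w : E² => Gp (w 1)) (ishPullback lam T F Ξ Ξx t (diagFrame z)) :=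
    hG.comp (ishPullback lam T F Ξ Ξx t (diagFrame z)) hf1
  have hframe := transport_comp_ishPullback (Θ := fun w : E² => Gp (w 1)) hproj hlam hTx hF hpde ht hx hxx hxt hne
  have hslice : DifferentiableAt ℝ (Θf t) (diagFrame z) :=
    hproj.comp _ (hasFDerivAt_ishPullback hlam hTx hF hx hxx hne).differentiableAt
  exact transport_conj_diagFrame (Θ := Θf)
    (V := ishVelocity lam lamx T Tx F Fu Fs (axialRate Ξx Ξt) (axialRateDeriv Ξx Ξt Ξxx Ξxt)) hslice hframe

/-- **The corner velocity is the perpendicular gradient of its stream function.** [folklore] -/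
theorem ishCornerVelocity_eq_perpGrad_ishCornerStream {lam lamx T Tx : ℝ → ℝ} {F Fu Fs : ℝ → ℝ → ℝ}
    {g gx : ℝ → ℝ → ℝ} {t : ℝ} {z : E²}
    (hg : HasDerivAt (g t) (gx t (ishAbscissa lam T (diagFrame z))) (ishAbscissa lam T (diagFrame z)))
    (hlam : HasDerivAt lam (lamx ((diagFrame z) 0)) ((diagFrame z) 0))
    (hTx : HasDerivAt T (Tx ((diagFrame z) 0)) ((diagFrame z) 0))
    (hF : HasFDerivAt (uncurry F)
      (Fu ((diagFrame z) 0) ((diagFrame z) 1 - T ((diagFrame z) 0)) • ContinuousLinearMap.fst ℝ ℝ ℝ +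
        Fs ((diagFrame z) 0) ((diagFrame z) 1 - T ((diagFrame z) 0)) • ContinuousLinearMap.snd ℝ ℝ ℝ)
      ((diagFrame z) 0, (diagFrame z) 1 - T ((diagFrame z) 0))) :
    ishCornerVelocity lam lamx T Tx F Fu Fs g gx t z = perpGrad (ishCornerStream lam T F g t) z := by
  have hframe := ishVelocity_eq_perpGrad_ishStream (t := t) (z := diagFrame z) hg hlam hTx hF
  have hH : DifferentiableAt ℝ (ishStream lam T F g t) (diagFrame z) :=
    (hasFDerivAt_ishStream hg hlam hTx hF).differentiableAt
  rw [ishCornerVelocity_apply, hframe, perpGrad_apply, diagFrameInv_perp_fderiv hH]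
  have hd : DifferentiableAt ℝ (fun w => ishStream lam T F g t (diagFrame w)) z :=
    differentiableAt_comp_diagFrame hH
  have e : ishCornerStream lam T F g t = fun w => 2⁻¹ * ishStream lam T F g t (diagFrame w) := rfl
  refine vec2_eq_perpGrad ?_ ?_
  · rw [e, fderiv_const_mul hd]; rfl
  · rw [e, fderiv_const_mul hd]; rfl

/-- **The corner velocity is divergence free** wherever it is the perpendicular gradient of a `C²`
stream function near the point (both hold for smooth data). [folklore] -/
theorem divergence_ishCornerVelocity {lam lamx T Tx : ℝ → ℝ} {F Fu Fs : ℝ → ℝ → ℝ} {g gx : ℝ → ℝ → ℝ}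
    {t : ℝ} {z : E²} (hH : ContDiffAt ℝ 2 (ishCornerStream lam T F g t) z)
    (heq : ishCornerVelocity lam lamx T Tx F Fu Fs g gx t =ᶠ[𝓝 z] perpGrad (ishCornerStream lam T F g t)) :
    ∑ j, fderiv ℝ (ishCornerVelocity lam lamx T Tx F Fu Fs g gx t) z (EuclideanSpace.single j 1) j = 0 := by
  have h : ∀ j, fderiv ℝ (ishCornerVelocity lam lamx T Tx F Fu Fs g gx t) z (EuclideanSpace.single j 1) j =
      fderiv ℝ (perpGrad (ishCornerStream lam T F g t)) z (EuclideanSpace.single j 1) j := fun j => by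
    rw [heq.fderiv_eq]
  simp only [h]
  exact divergence_perpGrad hH

/-! ## Smoothness and the static case -/

/-- **The corner scalar is smooth** when the profile and the data are. [folklore] -/
theorem contDiff_uncurry_ishCornerScalar {Gp : ℝ → G} {lam T : ℝ → ℝ} {F : ℝ → ℝ → ℝ} {Ξ Ξx : ℝ → ℝ → ℝ}
    (hGp : ContDiff ℝ ∞ Gp) (hlam : ContDiff ℝ ∞ lam) (hT : ContDiff ℝ ∞ T) (hF : ContDiff ℝ ∞ (uncurry F))
    (hΞ : ContDiff ℝ ∞ (uncurry Ξ)) (hΞx : ContDiff ℝ ∞ (uncurry Ξx)) (hne : ∀ t x, Ξx t x ≠ 0) :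
    ContDiff ℝ ∞ (uncurry (ishCornerScalar Gp lam T F Ξ Ξx)) := by
  have h1 : ContDiff ℝ ∞ (uncurry fun t w => (fun q : E² => Gp (q 1)) (ishPullback lam T F Ξ Ξx t w)) :=
    contDiff_uncurry_comp_ishPullback (hGp.comp (contDiff_coord 1)) hlam hT hF hΞ hΞx hne
  exact contDiff_uncurry_comp_diagFrame h1

/-- **The corner velocity is smooth** when its data are. [folklore] -/
theorem contDiff_uncurry_ishCornerVelocity {lam lamx T Tx : ℝ → ℝ} {F Fu Fs : ℝ → ℝ → ℝ} {g gx : ℝ → ℝ → ℝ}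
    (hlam : ContDiff ℝ ∞ lam) (hlamx : ContDiff ℝ ∞ lamx) (hT : ContDiff ℝ ∞ T) (hTx : ContDiff ℝ ∞ Tx)
    (hF : ContDiff ℝ ∞ (uncurry F)) (hFu : ContDiff ℝ ∞ (uncurry Fu)) (hFs : ContDiff ℝ ∞ (uncurry Fs))
    (hg : ContDiff ℝ ∞ (uncurry g)) (hgx : ContDiff ℝ ∞ (uncurry gx)) :
    ContDiff ℝ ∞ (uncurry (ishCornerVelocity lam lamx T Tx F Fu Fs g gx)) :=
  contDiff_uncurry_conj_diagFrame (contDiff_uncurry_ishVelocity hlam hlamx hT hTx hF hFu hFs hg hgx)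

/-- **The corner stream function is smooth** when `λ, T, F, g` are. [folklore] -/
theorem contDiff_uncurry_ishCornerStream {lam T : ℝ → ℝ} {F : ℝ → ℝ → ℝ} {g : ℝ → ℝ → ℝ}
    (hlam : ContDiff ℝ ∞ lam) (hT : ContDiff ℝ ∞ T) (hF : ContDiff ℝ ∞ (uncurry F)) (hg : ContDiff ℝ ∞ (uncurry g)) :
    ContDiff ℝ ∞ (uncurry (ishCornerStream lam T F g)) :=
  contDiff_const.mul (contDiff_uncurry_comp_diagFrame (contDiff_uncurry_ishStream hlam hT hF hg))

/-- **A static corner does not move**: with vanishing rate data the velocity vanishes. [folklore] -/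
theorem ishCornerVelocity_eq_zero_of_static {lam lamx T Tx : ℝ → ℝ} {F Fu Fs : ℝ → ℝ → ℝ} {g gx : ℝ → ℝ → ℝ}
    {t : ℝ} {z : E²} (hg : g t (ishAbscissa lam T (diagFrame z)) = 0)
    (hgx : gx t (ishAbscissa lam T (diagFrame z)) = 0) :
    ishCornerVelocity lam lamx T Tx F Fu Fs g gx t z = 0 := by
  rw [ishCornerVelocity_apply, ishVelocity_eq_zero hg hgx, diagFrameInv_apply]
  simp [vec2_eq_zero_iff]

end PlanarKinematics

end Literature.Analysis.FluidPDE
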